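import Mathlib
import HarnessLib

/-!
# Unequal blocks: the equal-weight bias correction MOVES a linear statistic; the `N/n_r`-weighted
# (delete-a-group) pseudo-values do not

HONEST FRAMING: exact (Metropolis-corrected) sampling algorithms for lattice gauge theory;
figures of merit are autocorrelation/cost numbers at stated couplings and volumes; no
continuum-physics claim.

Venture `LatticeQCDFlow` (cell pub-lqcd), topic `Exactness`; FANOUT row 13 (`eng-snf`, GEN-25).
NEW WORK of the cell (elementary algebra), Mathlib only; not a published result; no definition;
nothing cited as a fact (Quenouille / Tukey; the delete-a-group weights NAMED ONLY).  Companion of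
GEN-25 `…ReplicaJackknifePseudoValuesMean` (EQUAL blocks: pseudo-values of a mean are the block
values, `bias_corr = full`).

WHY (row 13).  `estimators._blocks` returns EQUAL-length contiguous blocks up to one element
(`linspace` edges), but with `block_ids` (streams of different lengths) the blocks have arbitrary
sizes `n_r > 0`, `N = Σ_r n_r`.  For the pooled MEAN of block sums `s_r` (`full = (Σ_r s_r)/N`,
delete-one-block replicate `rep_r = (Σ_s s_s − s_r)/(N − n_r)`) the engine's equal-weight
Quenouille–Tukey value `bias_corr = R·full − (R−1)·(1/R)Σ_r rep_r` satisfies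

  `rep_r − full = (n_r·full − s_r)/(N − n_r)`                    (`looPooledMean_sub_pooledMean`),
  **`bias_corr − full = ((R−1)/R)·Σ_r (s_r − n_r·full)/(N − n_r)`**
  (`biasCorrected_pooledMean_sub`),

which VANISHES when all `n_r` are equal (`biasCorrected_pooledMean_eq_of_const_size`: then
`Σ_r (s_r − n_r full) = 0` carries through the common denominator) but NOT in general
(`biasCorrected_pooledMean_ne_witness`: sizes `1 | 2`, block sums `0 | 2`: `full = 2/3`,
replicates `1`, `0`, `bias_corr = 5/6 ≠ 2/3`) — an unbiased linear statistic is "corrected" by a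
size-imbalance artefact.  The remedy is classical: with the delete-a-group weights `h_r = N/n_r`
the weighted pseudo-values `h_r·full − (h_r − 1)·rep_r` ARE the block means `s_r/n_r`
(`weightedPseudoValue_pooledMean_eq`) and their `n_r/N`-weighted average is `full` again
(`sum_weight_mul_weightedPseudoValue_eq`), for every size profile.

NOT CLAIMED: anything stochastic; anything about nonlinear statistics with unequal blocks;
anything numerical beyond the rational witness.
-/

namespace Summit.Ventures.LatticeQCDFlow.Exactness.GeneralNCMC

open Finset

section UnequalBlocks

variable {ι : Type*} [Fintype ι]

/-- **`rep_r − full = (n_r·full − s_r)/(N − n_r)`** (`N ≠ 0`, `N − n_r ≠ 0`; `full = (Σ s)/N`;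
in the application `N = Σ_r n_r`, but the identity holds for every `N`). -/
theorem looPooledMean_sub_pooledMean {nsz s : ι → ℝ} {N full : ℝ}
    (hfull : full = (∑ r, s r) / N) (hN0 : N ≠ 0) (r : ι) (hNr : N - nsz r ≠ 0) :
    ((∑ t, s t) - s r) / (N - nsz r) - full = (nsz r * full - s r) / (N - nsz r) := by
  have hS : ∑ t, s t = N * full := by rw [hfull, mul_div_cancel₀ _ hN0]
  rw [hS]
  field_simp
  ring

/-- **`bias_corr − full = ((R−1)/R)·Σ_r (s_r − n_r·full)/(N − n_r)`** — the equal-weight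
Quenouille–Tukey correction of the pooled mean with blocks of sizes `n_r`. -/
theorem biasCorrected_pooledMean_sub [Nonempty ι] {nsz s : ι → ℝ} {N full : ℝ}
    (hfull : full = (∑ r, s r) / N) (hN0 : N ≠ 0) (hNr : ∀ r, N - nsz r ≠ 0) :
    (Fintype.card ι : ℝ) * full
          - ((Fintype.card ι : ℝ) - 1) * ((∑ r, ((∑ t, s t) - s r) / (N - nsz r)) / Fintype.card ι)
        - full
      = ((Fintype.card ι : ℝ) - 1) / Fintype.card ι * ∑ r, (s r - nsz r * full) / (N - nsz r) := by
  have hR : (Fintype.card ι : ℝ) ≠ 0 := by positivity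
  -- replace each replicate by `full + (n_r full − s_r)/(N − n_r)`
  have hrep : ∀ r, ((∑ t, s t) - s r) / (N - nsz r)
      = full + (nsz r * full - s r) / (N - nsz r) := fun r => by
    have h := looPooledMean_sub_pooledMean hfull hN0 r (hNr r)
    linarith
  simp_rw [hrep]
  rw [sum_add_distrib, sum_const, card_univ, nsmul_eq_mul]
  have hneg : ∑ r, (nsz r * full - s r) / (N - nsz r)
      = -∑ r, (s r - nsz r * full) / (N - nsz r) := by
    rw [← sum_neg_distrib]
    exact sum_congr rfl fun r _ => by rw [← neg_div, neg_sub]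
  rw [hneg]
  field_simp
  ring

/-- **Equal sizes ⇒ `bias_corr = full`**: if every `n_r = c` then the correction vanishes
(`Σ_r (s_r − c·full) = N·full − R·c·full = 0` since `N = R·c`). -/
theorem biasCorrected_pooledMean_eq_of_const_size [Nonempty ι] {nsz s : ι → ℝ} {N full c : ℝ}
    (hN : N = ∑ r, nsz r) (hfull : full = (∑ r, s r) / N) (hN0 : N ≠ 0)
    (hc : ∀ r, nsz r = c) (hNc : N - c ≠ 0) :
    (Fintype.card ι : ℝ) * full
          - ((Fintype.card ι : ℝ) - 1) * ((∑ r, ((∑ t, s t) - s r) / (N - nsz r)) / Fintype.card ι)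
      = full := by
  have hNr : ∀ r, N - nsz r ≠ 0 := fun r => by rw [hc r]; exact hNc
  have h := biasCorrected_pooledMean_sub hfull hN0 hNr
  have hsum : ∑ r, (s r - nsz r * full) / (N - nsz r) = 0 := by
    simp_rw [hc]
    rw [← sum_div, sum_sub_distrib, sum_const, card_univ, nsmul_eq_mul]
    have hS : ∑ t, s t = N * full := by rw [hfull, mul_div_cancel₀ _ hN0]
    have hN' : N = (Fintype.card ι : ℝ) * c := by
      rw [hN]; simp_rw [hc]; rw [sum_const, card_univ, nsmul_eq_mul]
    rw [hS, hN']
    ring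
  rw [hsum, mul_zero] at h
  linarith

/-- **Unequal sizes ⇒ `bias_corr ≠ full` in general**: sizes `1 | 2`, block sums `0 | 2`
(`N = 3`, `full = 2/3`, replicates `(2 − 0)/(3 − 1) = 1` and `(2 − 2)/(3 − 2) = 0`):
`bias_corr = 2·(2/3) − (1 + 0)/2 = 5/6 ≠ 2/3`. -/
theorem biasCorrected_pooledMean_ne_witness :
    (2 : ℝ) * (2 / 3) - (2 - 1) * (((2 - 0) / (3 - 1) + (2 - 2) / (3 - 2)) / 2) = 5 / 6 ∧
      (5 / 6 : ℝ) ≠ 2 / 3 := by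
  constructor <;> norm_num

/-- **The delete-a-group remedy**: with weights `h_r = N/n_r` the weighted pseudo-value of the
pooled mean IS the block mean, `h_r·full − (h_r − 1)·rep_r = s_r/n_r`, for every size profile. -/
theorem weightedPseudoValue_pooledMean_eq {nsz s : ι → ℝ} {N full : ℝ}
    (hfull : full = (∑ r, s r) / N) (hN0 : N ≠ 0) (r : ι) (hnr : nsz r ≠ 0)
    (hNr : N - nsz r ≠ 0) :
    N / nsz r * full - (N / nsz r - 1) * (((∑ t, s t) - s r) / (N - nsz r)) = s r / nsz r := by
  have hS : ∑ t, s t = N * full := by rw [hfull, mul_div_cancel₀ _ hN0]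
  rw [hS]
  field_simp
  ring

/-- … and the `n_r/N`-weighted average of these pseudo-values is `full` again. -/
theorem sum_weight_mul_weightedPseudoValue_eq {nsz s : ι → ℝ} {N full : ℝ}
    (hfull : full = (∑ r, s r) / N) (hN0 : N ≠ 0) (hnr : ∀ r, nsz r ≠ 0)
    (hNr : ∀ r, N - nsz r ≠ 0) :
    ∑ r, nsz r / N
        * (N / nsz r * full - (N / nsz r - 1) * (((∑ t, s t) - s r) / (N - nsz r))) = full := by
  simp_rw [fun r => weightedPseudoValue_pooledMean_eq hfull hN0 r (hnr r) (hNr r)]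
  have h : ∀ r, nsz r / N * (s r / nsz r) = s r / N := fun r => by
    have := hnr r
    field_simp
  simp_rw [h]
  rw [← sum_div, hfull]

end UnequalBlocks

end Summit.Ventures.LatticeQCDFlow.Exactness.GeneralNCMC
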